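import Summits.QuantumFields.YangMills.Theorems.BalabanLadderNTSubsequentialGrowthOn
import Summits.QuantumFields.YangMills.Theorems.BalabanLadderNTSubsequentialBridge
import HarnessLib

/-!
# Route `BalabanLadder` (cruxes `NT` 19353, `UV` 19351, `IR` 19354): the summit bridge reads ALL FOUR LEGS on ONE cofinal set
# of couplings — `YangMills ⇐ ∃ (r, a, Bset)`: UV's collar bounds, IR's clustering and NT's floors AT THE COUPLINGS OF `Bset`

Helper file (`--supports stmt-QuantumFields-19353`) of the fleet lead prover of crux `NT` (unit `ym-spine-19353-p1`, g29),
hypothesis-free; completes the «weakest unknown consequence» series `…NTSubsequential*` by weakening the last leg still read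
globally by the bridge, `UV = MomentBounds6 G r a` (`∀ β ≥ β₄`), to the same bounds at the couplings of the cofinal set `Bset`.

* §1 **the vacuous-unit extension** (`exists_unit_extension_of_momentBounds6On`): collar bounds ON `Bset` at unit `a` are the
  GLOBAL `MomentBounds6 G r ã` for the unit `ã = a` on `Bset`, `ã = ℓ₄ + 1` elsewhere (off `Bset` the collar admissibility
  `R·ã β ≤ ℓ₄`, `R ≥ 1` is void); `softBundle_congr_unit` (a soft bundle in units `a` is one in units `ã` when the two agree at
  the scheme couplings — the unit enters `SoftBundle` only there).  So the tree's `stub_density` and `exists_planeString_bounds`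
  apply VERBATIM at `ã` and are read back at `a` on `Bset`; the growth step is `softLegs_joint_growth_onSet` (previous file).
* §2 `osDataWithGap_of_legs_germ_onSet`, `osDataWithGap_of_legs_onSet`, **`yangMills_of_legs_onSet`** —
  `YangMills ⇐ ∀ G simple ∃ r a Bset: a > 0 ∧ a → 0 ∧ Bset cofinal ∧ ROT G r a ∧` (collar bounds `MomentBounds6`-on-`Bset`)
  `∧` (`GapInUnits` family on `Bset`) `∧` (NT's two floors at every `β ∈ Bset` on tori of unbounded size);
  **`yangMills_of_legs_along_sequence_all`** — the same along ONE tuned sequence `b_k → ∞` (all three lattice legs at the `b_k`).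

READING.  The deciding theorem of the spine is a statement about lattice Yang–Mills along any single tuned sequence of bare
couplings, at each coupling on demand-large tori: E0′ collar bounds (UV), clustering (IR) and the two non-triviality floors (NT)
there, plus the scheme-level rotation-Ward leg.  None of the three typed `∀ β ≥ β₀` quantifiers is load-bearing.  HONEST FRAMING:
bookkeeping over the tree bridge; every leg is a HYPOTHESIS; `UV`, `NT`, `IR`, the gap and `YangMills` are NOT proved. [folklore]
-/

set_option autoImplicit false

noncomputable section

open scoped SchwartzMap ComplexConjugate BigOperators
open MeasureTheory Filter Topology
open Literature.MathematicalPhysics.QuantumFieldTheory Literature.MathematicalPhysics.QuantumLattice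
open Literature.MathematicalPhysics.AQFT Literature.Probability.LatticeModels
open Summit.QuantumFields.YangMills.Cruxes.OSLegsFromFemtoAndGap.DlrCollarTransfer
open Summit.QuantumFields.YangMills.Cruxes.OSLegsAtWeakCouplingC.Sketch
open Summit.QuantumFields.YangMills.Theorems.OSLegsFromFemtoAndGap
  (isHermitian_of_isReflectionPositive latticeDist softLegs_joint_growth_onSet exists_planeString_bounds)
open Summit.QuantumFields.YangMills.Theorems.HypercubicLimit.Negative (onlySpecies latticeSchwinger_onlySpecies_self)
open Summit.QuantumFields.YangMills.Theorems.NPointIsotropy.Negative (E4)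

namespace Summit.QuantumFields.YangMills.Cruxes.OSLegsAtWeakCouplingC.Y2Bridge

/-! ## §1 The vacuous-unit extension and the unit-congruence of soft bundles -/

section Extension

variable {G : Type} [Group G] [TopologicalSpace G] [IsTopologicalGroup G] [CompactSpace G]
  [MeasurableSpace G] [BorelSpace G]

/-- **Collar bounds on `Bset` are global collar bounds for an extended unit.**  If the body of `MomentBounds6 G r a` holds at
the couplings of `Bset`, then for the unit `ã` equal to `a` on `Bset` and to `ℓ₄ + 1` elsewhere, `MomentBounds6 G r ã` holds
(off `Bset` the admissibility `1 ≤ R`, `R·ã β ≤ ℓ₄` is contradictory); `ã` is positive if `a` is. [folklore] -/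
theorem exists_unit_extension_of_momentBounds6On (r : LatticeRep G) {a : ℝ → ℝ} (hapos : ∀ β, 0 < a β) (Bset : Set ℝ)
    (hUVon : ∃ (C β₄ ℓ₄ : ℝ), 0 < ℓ₄ ∧ 0 ≤ C ∧ ∀ β ∈ Bset, β₄ ≤ β →
      ∀ (L n : ℕ) (q : Fin n → Fin 4 × Fin 4) (x : Fin n → (Fin 4 → ℤ)) (R : ℕ), (∀ i, (q i).1 < (q i).2) →
        1 ≤ R → (R : ℝ) * a β ≤ ℓ₄ → 4 * R + 8 ≤ L →
        (∀ i j : Fin n, i ≠ j → ∃ k : Fin 4,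
          (2 * (R : ℤ) + 4) ≤ |((((x i k - x j k : ℤ) : ZMod (2 * L + 1))).valMinAbs : ℤ)|) →
        |torusE G r β L (fun U => ∏ i, (plane G r (q i) (x i) U - torusE G r β L (plane G r (q i) (x i))))| ≤
          (C / (R : ℝ) ^ 4) ^ n) :
    ∃ ã : ℝ → ℝ, (∀ β ∈ Bset, ã β = a β) ∧ (∀ β, 0 < ã β) ∧ MomentBounds6 G r ã := by
  classical
  obtain ⟨C, β₄, ℓ₄, hℓ, hC, H⟩ := hUVon
  refine ⟨fun β => if β ∈ Bset then a β else ℓ₄ + 1, fun β hβ => by simp [hβ], fun β => ?_, ?_⟩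
  · by_cases hβ : β ∈ Bset
    · simp only [hβ, if_true]; exact hapos β
    · simp only [hβ, if_false]; linarith
  · refine ⟨C, β₄, ℓ₄, hℓ, hC, fun β hβ4 L n q x R hq hR hRa hRL hsep => ?_⟩
    by_cases hβ : β ∈ Bset
    · simp only [hβ, if_true] at hRa
      exact H β hβ hβ4 L n q x R hq hR hRa hRL hsep
    · exfalso
      simp only [hβ, if_false] at hRa
      have h1 : (1 : ℝ) ≤ R := by exact_mod_cast hR
      nlinarith

/-- **Soft bundles see the unit only at the scheme couplings**: if `a` and `ã` agree at every `sch.β k`, a soft bundle in units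
`a` is a soft bundle in units `ã`. [folklore] -/
theorem softBundle_congr_unit (r : LatticeRep G) {a ã : ℝ → ℝ} {sch : SpeciesScheme (YMSpecies G)} {S₁ : SchwingerFamily E4}
    {Tq : (n : ℕ) → (Fin n → Fin 4 × Fin 4) → (𝓢((Fin n → E4), ℂ) →L[ℂ] ℂ)} {K b₀ : ℝ} {g : ℝ → ℕ → ℕ}
    (hagree : ∀ k, a (sch.β k) = ã (sch.β k)) (hB : SoftBundle G r a sch S₁ Tq K b₀ g) :
    SoftBundle G r ã sch S₁ Tq K b₀ g := by
  obtain ⟨⟨hunits, rest⟩, hdem⟩ := hB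
  exact ⟨⟨fun k => (hunits k).trans (hagree k), rest⟩, hdem⟩

end Extension

/-! ## §2 The bridge with every leg on one cofinal set of couplings -/

section OneGroup

variable {G : Type} [Group G] [TopologicalSpace G] [IsTopologicalGroup G] [CompactSpace G]
  [MeasurableSpace G] [BorelSpace G]

/-- **OS data with BOTH gaps, every leg read on one cofinal set `Bset`, any germ mechanism.**  From `a > 0`, `a → 0`, the
collar bounds `MomentBounds6`-on-`Bset`, NT's subsequential floors on `Bset`, the `GapInUnits` family on `Bset`, and a germ
mechanism for schemes in units `a`: OS data that is Yang–Mills for `r` along a scheme in units `a` (couplings in `Bset`),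
non-trivial, non-Gaussian, with both gaps. [folklore] -/
theorem osDataWithGap_of_legs_germ_onSet (r : LatticeRep G) (a : ℝ → ℝ) (hapos : ∀ β, 0 < a β)
    (ha0 : Tendsto a atTop (𝓝 0)) (Bset : Set ℝ) (hBcof : ∀ x : ℝ, ∃ β ∈ Bset, x ≤ β)
    (hUVon : ∃ (C β₄ ℓ₄ : ℝ), 0 < ℓ₄ ∧ 0 ≤ C ∧ ∀ β ∈ Bset, β₄ ≤ β →
      ∀ (L n : ℕ) (q : Fin n → Fin 4 × Fin 4) (x : Fin n → (Fin 4 → ℤ)) (R : ℕ), (∀ i, (q i).1 < (q i).2) →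
        1 ≤ R → (R : ℝ) * a β ≤ ℓ₄ → 4 * R + 8 ≤ L →
        (∀ i j : Fin n, i ≠ j → ∃ k : Fin 4,
          (2 * (R : ℤ) + 4) ≤ |((((x i k - x j k : ℤ) : ZMod (2 * L + 1))).valMinAbs : ℤ)|) →
        |torusE G r β L (fun U => ∏ i, (plane G r (q i) (x i) U - torusE G r β L (plane G r (q i) (x i))))| ≤
          (C / (R : ℝ) ^ 4) ^ n)
    (hNTsub : ∃ (v : 𝓢(E4, ℝ)) (ε : ℝ) (f g h : 𝓢(E4, ℝ)) (ε' : ℝ),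
      tsupport (v : E4 → ℝ) ⊆ {y : E4 | 0 < y 0} ∧ 0 < ε ∧
      Disjoint (tsupport f) (tsupport g) ∧ Disjoint (tsupport g) (tsupport h) ∧ Disjoint (tsupport f) (tsupport h) ∧
      0 < ε' ∧ ∀ β ∈ Bset, ∀ D : ℕ, ∃ L : ℕ, D ≤ L ∧
        ε ≤ Q2 G r β L (a β) (thetaTest 4 v) v ∧ ε' ≤ |Q3 G r β L (a β) f g h|)
    (hIRon : ∃ (c₁ β₂ : ℝ) (S₁ : ℝ → ℕ), 0 < c₁ ∧ ∀ A B : YMSpecies G, ∃ C : ℝ, ∀ β ∈ Bset, β₂ ≤ β →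
      ∀ S n : ℕ, S₁ β ≤ S → n ≤ S →
        |latticeConnectedCorr r.ρ β (2 * S + 1) A.F B.F n| ≤ C * Real.exp (-(c₁ * a β * n)))
    (hGERM : ∀ (sch : SpeciesScheme (YMSpecies G)) (S₁ : SchwingerFamily E4)
      (Tq : (n : ℕ) → (Fin n → Fin 4 × Fin 4) → (𝓢((Fin n → E4), ℂ) →L[ℂ] ℂ)) (K b₀ : ℝ) (g : ℝ → ℕ → ℕ),
      SoftBundle G r a sch S₁ Tq K b₀ g → OffDiagDensity S₁ →
        ∃ r₁ : ℝ, 0 < r₁ ∧ ∀ R : E4 ≃ₗᵢ[ℝ] E4, LinearMap.det (R.toLinearEquiv : E4 →ₗ[ℝ] E4) = 1 →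
          IsPlanar01 R → GermInvariant S₁ R r₁) :
    ∃ (sch : SpeciesScheme (YMSpecies G)) (T : OSData (YMSpecies G) 4),
      (∀ k, sch.a k = a (sch.β k)) ∧ sch.HasWeakCouplingLimit ∧ IsYangMillsFor r sch T ∧
        T.IsNontrivial r.curvature ∧ T.IsNonGaussian r.curvature ∧
        ∃ Δ > 0, T.HasMassGap Δ ∧ HasLatticeMassGap r sch Δ := by
  -- the vacuous-unit extension: global collar bounds at `ã = a` on `Bset`
  obtain ⟨ã, hagree, hãpos, hMB6⟩ := exists_unit_extension_of_momentBounds6On r hapos Bset hUVon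
  -- the a-uniform plane-string bounds at `ã`, read back at `a` on `Bset`
  obtain ⟨β₄, ℓ₄, K₀, hℓ, hK₀, Hbd⟩ := exists_planeString_bounds r hMB6
  -- the rope's demands (IR on `Bset`), then the soft bundle with every leg read on `Bset`
  obtain ⟨b₀, g, Δ, hΔ, hRD⟩ := stub_rope_onCouplings r a hapos ha0 Bset hIRon
  obtain ⟨sch, S₁, Tq, K, hB, hmem⟩ :=
    softLegs_joint_growth_onSet r hapos ha0 Bset hBcof hℓ hK₀
      (fun β hβ hβ4 ha ha24 haℓ L hL14 hLa n hn q hq F hF => by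
        rw [show a β = ã β from (hagree β hβ).symm] at ha ha24 haℓ hLa ⊢
        exact Hbd β hβ4 ha ha24 haℓ L hL14 hLa n hn q hq F hF)
      hNTsub hIRon b₀ g
  obtain ⟨hRP, hDec⟩ := hRD sch S₁ Tq K hB hmem
  have hsigned : ∀ R : E4 ≃ₗᵢ[ℝ] E4, IsSignedPerm R → Invariant S₁ R :=
    fun R hR n F hF => stub_hypercubic G r a sch S₁ Tq K b₀ g hB n R hR F hF
  -- densities: the tree's `stub_density` at the extended unit (the bundle in units `ã`)
  have hB' : SoftBundle G r ã sch S₁ Tq K b₀ g := softBundle_congr_unit r (fun k => (hagree _ (hmem k)).symm) hB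
  have hdens : OffDiagDensity S₁ := stub_density G r ã sch S₁ Tq K b₀ g hMB6 hB'
  -- unpack the bundle
  obtain ⟨⟨hunits, -, -, hβ, hN, hLG, hE3, htrans, h0, h1', -, -, hYM, hnt, hng, ⟨Δ', hΔ', hlat⟩, hranges, -⟩, -⟩ :=
    id hB
  -- E1: det-1 planar germ invariance (from the abstract mechanism) ⇒ planar invariance ⇒ SO(4)
  obtain ⟨r₁, hr₁, hgermR⟩ := hGERM sch S₁ Tq K b₀ g hB hdens
  -- continuum side
  obtain ⟨hCS, hgapOf⟩ := stub_gap S₁ h0 htrans hRP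
  have hE4 : S₁.toLabelled.HasClusterProperty :=
    stub_cluster S₁ Δ hΔ h0 h1' htrans (fun n R hR F hF => hsigned R hR n F hF) hCS hDec
  have hplanar : ∀ R : E4 ≃ₗᵢ[ℝ] E4, LinearMap.det (R.toLinearEquiv : E4 →ₗ[ℝ] E4) = 1 → IsPlanar01 R →
      Invariant S₁ R := fun R hdet hR =>
    stub_locality S₁ h0 htrans hE3 hLG hRP hsigned hdens R hR r₁ hr₁ (hgermR R hdet hR)
  have hE1 : S₁.toLabelled.IsEuclideanInvariant := isEuclideanInvariant_of_planarRot S₁ htrans hsigned hplanar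
  have hE2 : S₁.toLabelled.IsReflectionPositive := isReflectionPositive_of_rpPos hRP
  have hherm : S₁.toLabelled.IsHermitian := isHermitian_of_isReflectionPositive S₁ hN hE2
  have hOS : OSAxiomsSchwinger S₁.toLabelled :=
    { normalized := hN, hermitian := hherm, invariant := hE1, reflectionPositive := hE2, symmetric := hE3,
      cluster := hE4, linearGrowth := hLG }
  have hgap : S₁.toLabelled.HasMassGap Δ := hgapOf Δ hΔ hDec
  have hΔ₀ : 0 < min Δ Δ' := lt_min hΔ hΔ'
  have hgap₀ : S₁.toLabelled.HasMassGap (min Δ Δ') := hasMassGap_anti hgap (min_le_left _ _)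
  have hlat₀ : HasLatticeMassGap r sch (min Δ Δ') := hasLatticeMassGap_anti r sch hlat (min_le_right _ _)
  have hc : ∀ s : YMSpecies G, s ≠ r.curvature → ∀ k, (onlySpecies sch r.curvature).c s k = 0 := by
    intro s hs k
    simp [onlySpecies, hs]
  have hconv : ∀ n : ℕ, n ≠ 0 → ∀ (f : Fin n → 𝓢(E4, ℝ)) (F : 𝓢((Fin n → E4), ℂ)),
      IsTensorOf F (fun i => ofRealTest (f i)) → IsOffDiagonal F →
        Tendsto (fun k : ℕ => ((latticeSchwinger r.ρ (onlySpecies sch r.curvature) (fun s => s.F) k n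
          (fun _ => r.curvature) f : ℝ) : ℂ)) atTop
          (𝓝 ((OSData.ofAxioms S₁.toLabelled hOS).schwinger n (fun _ => ()) F)) := by
    intro n hn f F hF hod
    simp_rw [latticeSchwinger_onlySpecies_self]
    rw [OSData.ofAxioms_schwinger, SchwingerFamily.toLabelled_apply]
    exact hYM n hn f F hF hod
  have hNT' : (OSData.ofAxioms S₁.toLabelled hOS).IsNontrivial () := by
    unfold OSData.IsNontrivial
    simpa only [OSData.ofAxioms_schwinger] using hnt
  have hNG' : (OSData.ofAxioms S₁.toLabelled hOS).IsNonGaussian () := by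
    unfold OSData.IsNonGaussian
    simpa only [OSData.ofAxioms_schwinger] using hng
  have hgapT : (OSData.ofAxioms S₁.toLabelled hOS).HasMassGap (min Δ Δ') := by
    unfold OSData.HasMassGap
    simpa only [OSData.ofAxioms_schwinger] using hgap₀
  obtain ⟨T, hYM', hntT, hngT, Δ₁, hΔ₁, hgapT', hlatT⟩ :=
    exists_yangMillsWitness_of_oneSpecies r (onlySpecies sch r.curvature) hc (OSData.ofAxioms S₁.toLabelled hOS)
      hconv hNT' hNG' hΔ₀ hgapT hlat₀
  exact ⟨onlySpecies sch r.curvature, T, hunits, hβ, hYM', hntT, hngT, Δ₁, hΔ₁, hgapT', hlatT⟩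

/-- **OS data with BOTH gaps from every leg on one cofinal set, rotation-Ward form of E1** (`ROT G r a`). [folklore] -/
theorem osDataWithGap_of_legs_onSet (r : LatticeRep G) (a : ℝ → ℝ) (hapos : ∀ β, 0 < a β)
    (ha0 : Tendsto a atTop (𝓝 0)) (Bset : Set ℝ) (hBcof : ∀ x : ℝ, ∃ β ∈ Bset, x ≤ β)
    (hUVon : ∃ (C β₄ ℓ₄ : ℝ), 0 < ℓ₄ ∧ 0 ≤ C ∧ ∀ β ∈ Bset, β₄ ≤ β →
      ∀ (L n : ℕ) (q : Fin n → Fin 4 × Fin 4) (x : Fin n → (Fin 4 → ℤ)) (R : ℕ), (∀ i, (q i).1 < (q i).2) →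
        1 ≤ R → (R : ℝ) * a β ≤ ℓ₄ → 4 * R + 8 ≤ L →
        (∀ i j : Fin n, i ≠ j → ∃ k : Fin 4,
          (2 * (R : ℤ) + 4) ≤ |((((x i k - x j k : ℤ) : ZMod (2 * L + 1))).valMinAbs : ℤ)|) →
        |torusE G r β L (fun U => ∏ i, (plane G r (q i) (x i) U - torusE G r β L (plane G r (q i) (x i))))| ≤
          (C / (R : ℝ) ^ 4) ^ n)
    (hNTsub : ∃ (v : 𝓢(E4, ℝ)) (ε : ℝ) (f g h : 𝓢(E4, ℝ)) (ε' : ℝ),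
      tsupport (v : E4 → ℝ) ⊆ {y : E4 | 0 < y 0} ∧ 0 < ε ∧
      Disjoint (tsupport f) (tsupport g) ∧ Disjoint (tsupport g) (tsupport h) ∧ Disjoint (tsupport f) (tsupport h) ∧
      0 < ε' ∧ ∀ β ∈ Bset, ∀ D : ℕ, ∃ L : ℕ, D ≤ L ∧
        ε ≤ Q2 G r β L (a β) (thetaTest 4 v) v ∧ ε' ≤ |Q3 G r β L (a β) f g h|)
    (hIRon : ∃ (c₁ β₂ : ℝ) (S₁ : ℝ → ℕ), 0 < c₁ ∧ ∀ A B : YMSpecies G, ∃ C : ℝ, ∀ β ∈ Bset, β₂ ≤ β →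
      ∀ S n : ℕ, S₁ β ≤ S → n ≤ S →
        |latticeConnectedCorr r.ρ β (2 * S + 1) A.F B.F n| ≤ C * Real.exp (-(c₁ * a β * n)))
    (hROT : ROT G r a) :
    ∃ (sch : SpeciesScheme (YMSpecies G)) (T : OSData (YMSpecies G) 4),
      (∀ k, sch.a k = a (sch.β k)) ∧ sch.HasWeakCouplingLimit ∧ IsYangMillsFor r sch T ∧
        T.IsNontrivial r.curvature ∧ T.IsNonGaussian r.curvature ∧
        ∃ Δ > 0, T.HasMassGap Δ ∧ HasLatticeMassGap r sch Δ := by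
  refine osDataWithGap_of_legs_germ_onSet r a hapos ha0 Bset hBcof hUVon hNTsub hIRon
    fun sch S₁ Tq K b₀ g hB hdens => ?_
  obtain ⟨⟨hunits, -, -, hβ, -, -, -, -, -, -, -, -, -, -, -, -, hranges, -⟩, -⟩ := id hB
  obtain ⟨r₀, hr₀, hW⟩ := hROT sch hunits hβ hranges
  exact germRotAt_of_latticeWardAt r a sch S₁ Tq K b₀ g hB hdens hr₀ hW

end OneGroup

/-- **`YangMills` from the four legs read on ONE cofinal set of couplings.**  For every compact simple `G`: SOME `r`, SOME
positive unit map `a → 0`, SOME cofinal `Bset` with: the collar bounds (`MomentBounds6` body) at the couplings of `Bset`, the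
`GapInUnits` family on `Bset`, NT's two floors at every `β ∈ Bset` on tori of unbounded size, and the scheme-level `ROT G r a`. [folklore] -/
theorem yangMills_of_legs_onSet
    (hyp : ∀ (G : Type) [Group G] [TopologicalSpace G] [IsTopologicalGroup G] [CompactSpace G],
      IsCompactSimpleLieGroup G → letI : MeasurableSpace G := borel G; haveI : BorelSpace G := ⟨rfl⟩;
      ∃ (r : LatticeRep G) (a : ℝ → ℝ) (Bset : Set ℝ), (∀ β, 0 < a β) ∧ Tendsto a atTop (𝓝 0) ∧
        (∀ x : ℝ, ∃ β ∈ Bset, x ≤ β) ∧ ROT G r a ∧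
        (∃ (C β₄ ℓ₄ : ℝ), 0 < ℓ₄ ∧ 0 ≤ C ∧ ∀ β ∈ Bset, β₄ ≤ β →
          ∀ (L n : ℕ) (q : Fin n → Fin 4 × Fin 4) (x : Fin n → (Fin 4 → ℤ)) (R : ℕ), (∀ i, (q i).1 < (q i).2) →
            1 ≤ R → (R : ℝ) * a β ≤ ℓ₄ → 4 * R + 8 ≤ L →
            (∀ i j : Fin n, i ≠ j → ∃ k : Fin 4,
              (2 * (R : ℤ) + 4) ≤ |((((x i k - x j k : ℤ) : ZMod (2 * L + 1))).valMinAbs : ℤ)|) →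
            |torusE G r β L (fun U => ∏ i, (plane G r (q i) (x i) U - torusE G r β L (plane G r (q i) (x i))))| ≤
              (C / (R : ℝ) ^ 4) ^ n) ∧
        (∃ (c₁ β₂ : ℝ) (S₁ : ℝ → ℕ), 0 < c₁ ∧ ∀ A B : YMSpecies G, ∃ C : ℝ, ∀ β ∈ Bset, β₂ ≤ β →
          ∀ S n : ℕ, S₁ β ≤ S → n ≤ S →
            |latticeConnectedCorr r.ρ β (2 * S + 1) A.F B.F n| ≤ C * Real.exp (-(c₁ * a β * n))) ∧
        (∃ (v : 𝓢(E4, ℝ)) (ε : ℝ) (f g h : 𝓢(E4, ℝ)) (ε' : ℝ),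
          tsupport (v : E4 → ℝ) ⊆ {y : E4 | 0 < y 0} ∧ 0 < ε ∧
          Disjoint (tsupport f) (tsupport g) ∧ Disjoint (tsupport g) (tsupport h) ∧
          Disjoint (tsupport f) (tsupport h) ∧ 0 < ε' ∧
          ∀ β ∈ Bset, ∀ D : ℕ, ∃ L : ℕ, D ≤ L ∧
            ε ≤ Q2 G r β L (a β) (thetaTest 4 v) v ∧ ε' ≤ |Q3 G r β L (a β) f g h|)) :
    YangMills := by
  intro G _ _ _ _ hG
  letI : MeasurableSpace G := borel G
  haveI : BorelSpace G := ⟨rfl⟩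
  obtain ⟨r, a, Bset, hapos, ha0, hBcof, hROT, hUVon, hIRon, hNTsub⟩ := hyp G hG
  obtain ⟨sch, T, -, hβ, hYM, hnt, hng, Δ, hΔ, hgap, hlat⟩ :=
    osDataWithGap_of_legs_onSet r a hapos ha0 Bset hBcof hUVon hNTsub hIRon hROT
  exact ⟨r, sch, T, hβ, hYM, hnt, hng, Δ, hΔ, hgap, hlat⟩

/-- **`YangMills` from the four legs ALONG ONE TUNED SEQUENCE of couplings `b_k → ∞`**: collar bounds, clustering family and
NT's floors (tori of unbounded size) at the `b_k` only, plus the scheme-level `ROT`. [folklore] -/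
theorem yangMills_of_legs_along_sequence_all
    (hyp : ∀ (G : Type) [Group G] [TopologicalSpace G] [IsTopologicalGroup G] [CompactSpace G],
      IsCompactSimpleLieGroup G → letI : MeasurableSpace G := borel G; haveI : BorelSpace G := ⟨rfl⟩;
      ∃ (r : LatticeRep G) (a : ℝ → ℝ) (b : ℕ → ℝ), Tendsto b atTop atTop ∧ (∀ β, 0 < a β) ∧ Tendsto a atTop (𝓝 0) ∧
        ROT G r a ∧
        (∃ (C ℓ₄ : ℝ), 0 < ℓ₄ ∧ 0 ≤ C ∧ ∀ k : ℕ,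
          ∀ (L n : ℕ) (q : Fin n → Fin 4 × Fin 4) (x : Fin n → (Fin 4 → ℤ)) (R : ℕ), (∀ i, (q i).1 < (q i).2) →
            1 ≤ R → (R : ℝ) * a (b k) ≤ ℓ₄ → 4 * R + 8 ≤ L →
            (∀ i j : Fin n, i ≠ j → ∃ k' : Fin 4,
              (2 * (R : ℤ) + 4) ≤ |((((x i k' - x j k' : ℤ) : ZMod (2 * L + 1))).valMinAbs : ℤ)|) →
            |torusE G r (b k) L (fun U => ∏ i, (plane G r (q i) (x i) U - torusE G r (b k) L (plane G r (q i) (x i))))| ≤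
              (C / (R : ℝ) ^ 4) ^ n) ∧
        (∃ (c₁ : ℝ) (S₁ : ℝ → ℕ), 0 < c₁ ∧ ∀ A B : YMSpecies G, ∃ C : ℝ, ∀ k : ℕ,
          ∀ S n : ℕ, S₁ (b k) ≤ S → n ≤ S →
            |latticeConnectedCorr r.ρ (b k) (2 * S + 1) A.F B.F n| ≤ C * Real.exp (-(c₁ * a (b k) * n))) ∧
        (∃ (v : 𝓢(E4, ℝ)) (ε : ℝ) (f g h : 𝓢(E4, ℝ)) (ε' : ℝ),
          tsupport (v : E4 → ℝ) ⊆ {y : E4 | 0 < y 0} ∧ 0 < ε ∧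
          Disjoint (tsupport f) (tsupport g) ∧ Disjoint (tsupport g) (tsupport h) ∧
          Disjoint (tsupport f) (tsupport h) ∧ 0 < ε' ∧
          ∀ k : ℕ, ∀ D : ℕ, ∃ L : ℕ, D ≤ L ∧
            ε ≤ Q2 G r (b k) L (a (b k)) (thetaTest 4 v) v ∧ ε' ≤ |Q3 G r (b k) L (a (b k)) f g h|)) :
    YangMills := by
  refine yangMills_of_legs_onSet fun G _ _ _ _ hG => ?_
  letI : MeasurableSpace G := borel G
  haveI : BorelSpace G := ⟨rfl⟩
  obtain ⟨r, a, b, hb, hapos, ha0, hROT, ⟨C, ℓ₄, hℓ, hC, hUV⟩, ⟨c₁, S₁, hc₁, hIR⟩,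
    ⟨v, ε, f, g, h, ε', hv, hε, hfg, hgh, hfh, hε', hfl⟩⟩ := hyp G hG
  refine ⟨r, a, Set.range b, hapos, ha0, ?_, hROT, ?_, ?_, ?_⟩
  · intro x
    obtain ⟨k, hk⟩ := (hb.eventually_ge_atTop x).exists
    exact ⟨b k, Set.mem_range_self k, hk⟩
  · refine ⟨C, 0, ℓ₄, hℓ, hC, ?_⟩
    rintro β ⟨k, rfl⟩ - L n q x R hq hR hRa hRL hsep
    exact hUV k L n q x R hq hR hRa hRL hsep
  · refine ⟨c₁, 0, S₁, hc₁, fun A B => ?_⟩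
    obtain ⟨C', hC'⟩ := hIR A B
    refine ⟨C', ?_⟩
    rintro β ⟨k, rfl⟩ - S n hS hn
    exact hC' k S n hS hn
  · refine ⟨v, ε, f, g, h, ε', hv, hε, hfg, hgh, hfh, hε', ?_⟩
    rintro β ⟨k, rfl⟩ D
    exact hfl k D

end Summit.QuantumFields.YangMills.Cruxes.OSLegsAtWeakCouplingC.Y2Bridge

end
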